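import Summits.Parity.GeneralizedHardyLittlewood.Theorems.GreenTaoLevelTwoGITwoCyclicInverseBohrSize

/-!
# Route `GreenTaoLevelTwo`, crux `GITwo` (stmt-Parity-21275), line `birth`, stub `stub_cyclicInverse`:
# the popularity (Markov) step "large average of a `[0,1]`-valued function ⇒ many large values"

Forty-first helper file toward the XL stub `stub_cyclicInverse` (B. Green, T. Tao, *An inverse
theorem for the Gowers `U³(G)` norm*, arXiv:math/0503014, Thm. 68 = PEMS 51 (2008) Thm. 12.8).
A recurring elementary step of §9 (e.g. Step 2, after display (eq9.75): "since `|𝔼_{x∈B₂} e(2{x,y'−y})|`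
is bounded above by `1`, there exists `A ⊆ B₂` with `|A| ≥ c|B₂|/2` such that … `≥ c/2` for all
`y ∈ A`"): def-free, for an arbitrary finset.

* `card_filter_ge_of_sum_ge` — if `g ≤ 1` on `B`, `c ≥ 0` and `Σ_{y∈B} g(y) ≥ c #B` then
  `#{y ∈ B : c/2 ≤ g(y)} ≥ (c/2) #B`.

References: [GreenTao2008U3Inverse] arXiv:math/0503014, §9 Step 2 (popularity argument).
-/

namespace Summit.Parity.GeneralizedHardyLittlewood.GreenTaoLevelTwoGITwoCyclicInverse

open Finset

/-- **Popularity / Markov step**: if `g ≤ 1` on a finset `B`, `c ≥ 0` and `Σ_{y∈B} g(y) ≥ c · #B`,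
then at least `(c/2) · #B` elements `y ∈ B` have `g(y) ≥ c/2`. [folklore] -/
theorem card_filter_ge_of_sum_ge {α : Type*} (B : Finset α) (g : α → ℝ) {c : ℝ} (hc : 0 ≤ c)
    (hg1 : ∀ y ∈ B, g y ≤ 1) (hsum : c * #B ≤ ∑ y ∈ B, g y) :
    c / 2 * #B ≤ #(B.filter fun y => c / 2 ≤ g y) := by
  classical
  -- split the sum according to `g y ≥ c/2`
  have hsplit := (sum_filter_add_sum_filter_not B (fun y => c / 2 ≤ g y) g)
  have h1 : ∑ y ∈ B.filter (fun y => c / 2 ≤ g y), g y ≤ #(B.filter fun y => c / 2 ≤ g y) := by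
    calc ∑ y ∈ B.filter (fun y => c / 2 ≤ g y), g y
        ≤ ∑ y ∈ B.filter (fun y => c / 2 ≤ g y), (1 : ℝ) :=
          sum_le_sum fun y hy => hg1 y (mem_filter.mp hy).1
      _ = #(B.filter fun y => c / 2 ≤ g y) := by simp
  have h2 : ∑ y ∈ B.filter (fun y => ¬ c / 2 ≤ g y), g y ≤ c / 2 * #B := by
    have hcard : (#(B.filter fun y => ¬ c / 2 ≤ g y) : ℝ) ≤ #B := by
      exact_mod_cast card_le_card (filter_subset _ _)
    calc ∑ y ∈ B.filter (fun y => ¬ c / 2 ≤ g y), g y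
        ≤ ∑ y ∈ B.filter (fun y => ¬ c / 2 ≤ g y), c / 2 :=
          sum_le_sum fun y hy => (not_le.mp (mem_filter.mp hy).2).le
      _ = c / 2 * #(B.filter fun y => ¬ c / 2 ≤ g y) := by
          rw [sum_const, nsmul_eq_mul, mul_comm]
      _ ≤ c / 2 * #B := mul_le_mul_of_nonneg_left hcard (by linarith)
  rw [← hsplit] at hsum
  linarith

end Summit.Parity.GeneralizedHardyLittlewood.GreenTaoLevelTwoGITwoCyclicInverse
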